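import Mathlib.Tactic.Linarith
import Mathlib.Tactic.NormNum
import Mathlib.Tactic.Ring
import HarnessLib

/-!
# The (0,1) cell of the ι-window, XXXIV (companion B): the product ground `B₁ × B₂`, XXI — THE CORNER V, ADDENDUM 1: THEOREM II-VOID⁺ (the
# equivariant layer count) (report [XXXIV] `H2-ZERO-ONE-34.md` §13): arithmetic shadows

Family `hodge`, b2b cell `hweil` (helper of item stmt-HodgeConjecture-2524). Report
`run/shared/lean/b2b/hodge-weil/b2b-hweil-pv1-g46/H2-ZERO-ONE-34.md` ([XXXIV]) §13 (ADDENDUM 1). Context: in THEOREM II-VOID the x²-torsion `𝒦` of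
`𝒪_{W′}(−Y₁)` is filtered by two layers `Ξ(−2S)|_{D′}`, `Ξ(−S)|_{D′}` on the planar curve `D′ ⊂ S` of bidegree `(v′, h′)`; the two layers have OPPOSITE
ι-characters at the 36 fixed points of `S` (the ideal `𝒪(−S)` is odd), so their holomorphic Lefschetz numbers cancel and only HALF of their Euler characteristics
count against the invariant reservoir: `Λ⁺ = ½[(p₁ + p₂)h′ + 2qv′] + χ(𝒪_{D′}) + H¹ = (4n₃ − 2n′ − 2)h′ + (a₂ + d₃ − 5)v′ + H¹`. The theorems below are the integer
bookkeeping of this identity and of the type-1 cells it voids (`n₃ = n′ = 10`: every cell except seven with `d₃ = 3`; `n₃ = 9`, shapes 2–4: every cell with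
`d₃ ≥ 5`). None of the theorems claims geometry. HONEST FRAMING: census work inside the ladder's H2 test ((0,1) cell) on the SPECIAL fourfold `X₀`; nothing here
is a rung; no case of the Hodge conjecture is proved; no statement of [Markman 2025] / [Perry 2026] / [EdGFS 2025] is used.
-/

-- mandated namespace `Summit.HodgeConjecture.HodgeConjecture.…` (Problem = Summit) trips `linter.dupNamespace`; the lakefile disables it
-- tree-wide (weak option), restated here so stand-alone elaboration is warning-free too.
set_option linter.dupNamespace false

namespace Summit.HodgeConjecture.HodgeConjecture.WeilTypeLadder

section ProductGroundTwentyOneAddOne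

/-- **[XXXIV] 13.1 (LEMMA TOR⁺: the closed form of the equivariant layer count).** With `p₁ = a₁ + 2n₃ − 2n′`, `p₂ = p₁ − 2`, `q = a₂ + d₃ − 4`,
`v′ = a₁ − 2n₃`, `h′ = a₂ − d₃` and `2χ(𝒪_{D′}) = −2(v′h′ + v′ + h′)`:  `(p₁ + p₂)h′ + 2qv′ − 2(v′h′ + v′ + h′) = 2[(4n₃ − 2n′ − 2)h′ + (q − 1)v′]`. [`ring`] -/
theorem pg21e_lambda_plus_closed_form :
    ∀ a₁ a₂ n₃ d₃ n' : ℤ,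
      ((a₁ + 2 * n₃ - 2 * n') + (a₁ + 2 * n₃ - 2 * n' - 2)) * (a₂ - d₃) + 2 * (a₂ + d₃ - 4) * (a₁ - 2 * n₃)
        - 2 * ((a₁ - 2 * n₃) * (a₂ - d₃) + (a₁ - 2 * n₃) + (a₂ - d₃))
      = 2 * ((4 * n₃ - 2 * n' - 2) * (a₂ - d₃) + (a₂ + d₃ - 5) * (a₁ - 2 * n₃)) := by
  intro a₁ a₂ n₃ d₃ n'
  ring

/-- **[XXXIV] 13.2 (THEOREM II-VOID⁺, type 1, the `n₃ = n′ = 10` family).** `MAIN = 65d₃ − 39`, `OB = 0`, `Λ⁺ = 18(a₂ − d₃) + (a₂ + d₃ − 5)(a₁ − 20) + H¹` with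
`H¹ = 0` for `d₃ ≥ 4` and `H¹ ≤ 2(a₁ − 20)` for `d₃ = 3`. For `a₁ ∈ {20, 21}` and `4 ≤ d₃ ≤ a₂ ≤ 14`: `MAIN − Λ⁺ ≥ 2` (every such cell VOID; worst margin
`28` at `(21, 4, 14)`); for `d₃ = 3`: VOID iff `a₂ ≤ 11` (`a₁ = 20`) resp. `a₂ = 10` (`a₁ = 21`) — seven cells of the family remain. [`rcases` + `nlinarith` / `omega`] -/
theorem pg21e_iivoid_plus_nprime_family :
    (∀ a₁ d₃ a₂ : ℤ, (a₁ = 20 ∨ a₁ = 21) → 4 ≤ d₃ → d₃ ≤ a₂ → a₂ ≤ 14 →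
        2 ≤ (65 * d₃ - 39) - (18 * (a₂ - d₃) + (a₂ + d₃ - 5) * (a₁ - 20))) ∧
    ((65 : ℤ) * 4 - 39) - (18 * (14 - 4) + (14 + 4 - 5) * (21 - 20)) = 28 ∧
    (∀ a₂ : ℤ, 10 ≤ a₂ → (2 ≤ (65 * 3 - 39) - (18 * (a₂ - 3) + (a₂ + 3 - 5) * 0 + 0) ↔ a₂ ≤ 11)) ∧
    (∀ a₂ : ℤ, 10 ≤ a₂ → (2 ≤ (65 * 3 - 39) - (18 * (a₂ - 3) + (a₂ + 3 - 5) * 1 + 2) ↔ a₂ = 10)) := by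
  refine ⟨fun a₁ d₃ a₂ ha hd hda ha2 => ?_, by norm_num, fun a₂ h => ⟨fun h' => by omega, fun h' => by omega⟩,
    fun a₂ h => ⟨fun h' => by omega, fun h' => by omega⟩⟩
  rcases ha with rfl | rfl
  · nlinarith
  · nlinarith

/-- **[XXXIV] 13.2 (THEOREM II-VOID⁺, type 1, the `n₃ = 9` family in the finite shapes).** `MAIN = 42d₃ − 26`, `OB = 0`, `Λ⁺ = 14(a₂ − d₃) + (a₂ + d₃ − 5)(a₁ −
18)` (`d₃ ≥ 4`). For `a₁ ∈ {19, 20, 21}` (shapes 2–4; SIGN-CUT `a₂ ≤ 16 / 14 / 14`) and `5 ≤ d₃ ≤ a₂`: `MAIN − Λ⁺ ≥ 2` — every such cell VOID (worst margin `14` at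
`(19, 5, 16)`); at `d₃ = 4` the bound voids exactly `a₂ ≤ 13 / 12 / 11`. [`rcases` + `nlinarith` / `omega`] -/
theorem pg21e_iivoid_plus_nine_family :
    (∀ a₁ d₃ a₂ : ℤ, (a₁ = 19 ∨ a₁ = 20 ∨ a₁ = 21) → 5 ≤ d₃ → d₃ ≤ a₂ → (a₁ = 19 → a₂ ≤ 16) → (a₁ ≠ 19 → a₂ ≤ 14) →
        2 ≤ (42 * d₃ - 26) - (14 * (a₂ - d₃) + (a₂ + d₃ - 5) * (a₁ - 18))) ∧
    ((42 : ℤ) * 5 - 26) - (14 * (16 - 5) + (16 + 5 - 5) * (19 - 18)) = 14 ∧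
    (∀ a₂ : ℤ, 10 ≤ a₂ → (2 ≤ (42 * 4 - 26) - (14 * (a₂ - 4) + (a₂ + 4 - 5) * 1) ↔ a₂ ≤ 13)) ∧
    (∀ a₂ : ℤ, 10 ≤ a₂ → (2 ≤ (42 * 4 - 26) - (14 * (a₂ - 4) + (a₂ + 4 - 5) * 2) ↔ a₂ ≤ 12)) ∧
    (∀ a₂ : ℤ, 10 ≤ a₂ → (2 ≤ (42 * 4 - 26) - (14 * (a₂ - 4) + (a₂ + 4 - 5) * 3) ↔ a₂ ≤ 11)) := by
  refine ⟨fun a₁ d₃ a₂ ha hd hda h19 hne => ?_, by norm_num, fun a₂ h => ⟨fun h' => by omega, fun h' => by omega⟩,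
    fun a₂ h => ⟨fun h' => by omega, fun h' => by omega⟩, fun a₂ h => ⟨fun h' => by omega, fun h' => by omega⟩⟩
  rcases ha with rfl | rfl | rfl
  · have h16 : a₂ ≤ 16 := h19 rfl
    nlinarith
  · have h14 : a₂ ≤ 14 := hne (by norm_num)
    nlinarith
  · have h14 : a₂ ≤ 14 := hne (by norm_num)
    nlinarith

/-- **[XXXIV] 13.2 (the shape-1 threshold for `n₃ = 9`).** With `a₁ = 18` (`v′ = 0`): `Λ⁺ = 14(a₂ − d₃)` and the cell is VOID iff `42d₃ − 28 ≥ 14(a₂ − d₃)`,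
i.e. iff `a₂ ≤ 4d₃ − 2` (for `d₃ ≥ 4`); the a priori cap is `a₂ ≤ d₃ + W′·S/2 = 9d₃ + 26`, so the open tail is `4d₃ − 2 < a₂ ≤ 9d₃ + 26`. [`omega`] -/
theorem pg21e_iivoid_plus_nine_shape_one :
    (∀ d₃ a₂ : ℤ, 4 ≤ d₃ → (2 ≤ (42 * d₃ - 26) - 14 * (a₂ - d₃) ↔ a₂ ≤ 4 * d₃ - 2)) ∧
    (∀ d₃ : ℤ, d₃ + (52 + 16 * d₃) / 2 = 9 * d₃ + 26) := by
  refine ⟨fun d₃ a₂ hd => ⟨fun h => by omega, fun h => by omega⟩, fun d₃ => by omega⟩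

end ProductGroundTwentyOneAddOne

end Summit.HodgeConjecture.HodgeConjecture.WeilTypeLadder
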